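/-
Copyright (c) 2026 the pub-hodgecm-mathlib formalisation cell (harness21).  Prover seat hodgecm-mathlib-K2Liu-p08 (g6), Track B «K2-LIT»,
#184♮ = hLiu418 = `stmt-HodgeConjecture-24832`; #42S BLOCK D, row D-2, (σ-A) mini-road (LEAD F0P6-plan (g15) RULING M-160f ∕ BATCH #238; (σ-A) road desk
K2Liu-p25 (g3); (an-3c-charts) K2Liu-p12 (g6) FLAG 2), brick [A4-close] GUARDED: the D-2 cone socket with its cone letters owed ONLY AT DEAD bad places.
THEOREMS ONLY (no `def`, no `instance`, no `notation`, no named-fact hypothesis, no `sorry`, default heartbeats).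
-/
import Summits.HodgeConjecture.HodgeConjecture.Theorems.K2LiuLocalSWSeamOfRecord   -- ★ p864360 [A4-close]: the cone-word closer `exists_forall_setIntegral_conj_addChar_mul_coneWord_eq_zero`
import HarnessLib

-- buildfix G11b-3 recipe (LEDGER B13-1/B13-3), as in the GelbartRogawski1991 siblings: elaborate sequentially.
set_option Elab.async false

/-!
# Crux `HLiu418`, #42S BLOCK D, row D-2 — [A4-close] GUARDED: the D-2 socket of record with DEAD-GUARDED cone letters

Cell `hodgecm-mathlib`, crux item hLiu418 = `stmt-HodgeConjecture-24832` (helper lane `--supports … --as helper`, count-neutral; closes no socket); squad K2 ∕ K2Liu (L1).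
Prover K2Liu-p08 (g6) under the (σ-A) road desk K2Liu-p25 (g3); answers (an-3c-charts) K2Liu-p12 (g6) FLAG 2 (02:19:57Z).

WHY.  ★ p864360 §4 `hV_faces_of_coneWord` takes the cone letters `hZ`, `hcone` for EVERY bad place `v ∈ Tf X j h`, but its conclusion (★ p863475's `hV` binder) is
used only under `dead`.  At a SPLIT or live `v ∈ Tf` the dead hypothesis is false, while the cone word there would be a different (GL-type) analysis nobody owes:
the non-split chain ★ `chainValues_of_placeLetter` (e′) and (an-1)–(an-3) are NON-SPLIT statements.  THIS FILE re-states the socket with `hZ` and `hcone`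
DEAD-GUARDED (`¬((val X, θ)_v = −1 ↔ v ∈ S₁) → …`, exactly like `hclass′`) — same frame, same conclusion BYTES, proof = ★ p864360 §3 at the dead place.
* **`hV_faces_of_coneWord_of_dead`** — THE D-2 SOCKET OF RECORD (supersedes ★ p864360 §4 for the END assembler; 20 fewer obligations at non-dead places).
[KudlaRallis1994, §2 (2.10)–(2.12)] [MoeglinVignerasWaldspurger1987, Chap. 2 II.6].
HONEST LABEL.  Count-neutral helper; `hcone`∕`hZ`-carrier at dead places = [A4-an] BY VALUE until (an-1)–(an-3) ★; `HC_CM` is proved only modulo the 7 printed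
citations (2 remaining named inputs: hLiu418 = `stmt-HodgeConjecture-24832`, h413 = `stmt-HodgeConjecture-24833`) until rung 0 closes.

## References
* [KudlaRallis1994] S. Kudla, S. Rallis, *A regularized Siegel–Weil formula: the first term identity*, Ann. of Math. 140 (1994), §2 (2.10)–(2.12).
* [MoeglinVignerasWaldspurger1987] C. Mœglin, M.-F. Vignéras, J.-L. Waldspurger, LNM 1291 (1987), Chap. 2 II.6.
-/

set_option autoImplicit false
set_option linter.dupNamespace false -- the mandated namespace repeats `HodgeConjecture.HodgeConjecture`

noncomputable section

open scoped Matrix ComplexConjugate NNReal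
open NumberField IsDedekindDomain Matrix MeasureTheory Set Filter
open Literature.NumberTheory.QuadraticForms Literature.NumberTheory.Automorphic Literature.NumberTheory.Automorphic.UnitaryGroup
open Literature.NumberTheory.Automorphic.UnitaryGroup.QuadraticCoordinates
open Literature.NumberTheory.GaloisRepresentations Literature.NumberTheory.GaloisRepresentations.IsNonarchimedeanLocalField
open Literature.NumberTheory.GelbartRogawski1991 Literature.NumberTheory.GelbartRogawski1991.GRConstruction

namespace Summit.HodgeConjecture.HodgeConjecture.Cruxes.HLiu418.K2LiuLocalSWSeamOfRecordGuarded

open K2LiuSiegelUnipotentFourierDefs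
open K2LiuLocalSWSeamOfRecord (exists_forall_setIntegral_conj_addChar_mul_coneWord_eq_zero)

/-! ## §1 The D-2 socket with DEAD-GUARDED cone letters -/

section BallRoadGuarded

variable (L : Type) [Field L] [NumberField L] [IsCMField L]
variable {N M n : ℕ} (e : Fin N × Fin M ≃ Fin n)
  (dV : Fin N → L) (hdV : ∀ i, IsCMField.complexConj L (dV i) = dV i)
  (dW : Fin M → L) (hdW : ∀ i, IsCMField.complexConj L (dW i) = dW i)

variable {ι : skewMatrices ((IsCMField.complexConj L : L ≃ₐ[Fp L] L) : L →+* L) ((gramR L e dV hdV dW hdW).map (algebraMap (Fp L) L)) → Type}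

variable [∀ v : HeightOneSpectrum (𝓞 ↥(maximalRealSubfield L)), MeasurableSpace (v.adicCompletion ↥(maximalRealSubfield L))]
  [∀ v : HeightOneSpectrum (𝓞 ↥(maximalRealSubfield L)), BorelSpace (v.adicCompletion ↥(maximalRealSubfield L))]

/-- **ROW D-2'S `hV` LETTER FROM THE CONE WORD, DEAD-GUARDED ((an-3c-charts) K2Liu-p12 (g6) FLAG 2).**  Identical to ★ p864360 §4 `hV_faces_of_coneWord` except that the
cone letters `hZ` and `hcone` are owed ONLY AT DEAD bad places (`¬((val X, θ)_v = −1 ↔ v ∈ S₁) → …`, exactly like `hclass′`): at a SPLIT or live `v ∈ Tf X j h`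
the dead hypothesis is false and the letters are vacuous, so the non-split cone analysis ((an-1)–(an-3), ★ `chainValues_of_placeLetter` (e′)) is the only one the
road needs; the conclusion (★ p863475's `hV` binder BYTES) is itself dead-guarded, so no consumer changes. [cite: KudlaRallis1994, §2 (2.10)–(2.12)]
[cite: MoeglinVignerasWaldspurger1987, Chap. 2 II.6] -/
theorem hV_faces_of_coneWord_of_dead {φ : Type*}
    (S₁ : Finset (HeightOneSpectrum (𝓞 ↥(maximalRealSubfield L))))
    (val : Matrix (Fin n) (Fin n) L → ↥(maximalRealSubfield L))
    (I : ∀ X : skewMatrices ((IsCMField.complexConj L : L ≃ₐ[Fp L] L) : L →+* L) ((gramR L e dV hdV dW hdW).map (algebraMap (Fp L) L)),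
      ι X → HA L e dV hdV dW hdW → Finset φ)
    (Tf : ∀ X : skewMatrices ((IsCMField.complexConj L : L ≃ₐ[Fp L] L) : L →+* L) ((gramR L e dV hdV dW hdW).map (algebraMap (Fp L) L)),
      ι X → HA L e dV hdV dW hdW → Finset (HeightOneSpectrum (𝓞 ↥(maximalRealSubfield L))))
    (V : ∀ X : skewMatrices ((IsCMField.complexConj L : L ≃ₐ[Fp L] L) : L →+* L) ((gramR L e dV hdV dW hdW).map (algebraMap (Fp L) L)),
      ι X → HA L e dV hdV dW hdW → φ → HeightOneSpectrum (𝓞 ↥(maximalRealSubfield L)) → ℕ → ℂ)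
    (μ : ∀ v : HeightOneSpectrum (𝓞 ↥(maximalRealSubfield L)), Measure (v.adicCompletion ↥(maximalRealSubfield L))) [∀ v, (μ v).IsAddHaarMeasure]
    (σc : skewMatrices ((IsCMField.complexConj L : L ≃ₐ[Fp L] L) : L →+* L) ((gramR L e dV hdV dW hdW).map (algebraMap (Fp L) L)) →
      ∀ v : HeightOneSpectrum (𝓞 ↥(maximalRealSubfield L)), v.adicCompletion ↥(maximalRealSubfield L))
    (hσ : ∀ X v, σc X v ≠ 0)
    (Z : HeightOneSpectrum (𝓞 ↥(maximalRealSubfield L)) → Type*) [∀ v, MeasurableSpace (Z v)]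
    (ρ : ∀ X : skewMatrices ((IsCMField.complexConj L : L ≃ₐ[Fp L] L) : L →+* L) ((gramR L e dV hdV dW hdW).map (algebraMap (Fp L) L)),
      ι X → HA L e dV hdV dW hdW → φ → ∀ v : HeightOneSpectrum (𝓞 ↥(maximalRealSubfield L)), Measure (Z v))
    (hρ : ∀ X j h i v, SFinite (ρ X j h i v))
    (G : ∀ X : skewMatrices ((IsCMField.complexConj L : L ≃ₐ[Fp L] L) : L →+* L) ((gramR L e dV hdV dW hdW).map (algebraMap (Fp L) L)),
      ι X → HA L e dV hdV dW hdW → φ → ∀ v : HeightOneSpectrum (𝓞 ↥(maximalRealSubfield L)), Z v → ℂ)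
    (hG : ∀ X j h i v, Integrable (G X j h i v) (ρ X j h i v))
    (q : ∀ X : skewMatrices ((IsCMField.complexConj L : L ≃ₐ[Fp L] L) : L →+* L) ((gramR L e dV hdV dW hdW).map (algebraMap (Fp L) L)),
      ι X → HA L e dV hdV dW hdW → φ → ∀ v : HeightOneSpectrum (𝓞 ↥(maximalRealSubfield L)), Z v → v.adicCompletion ↥(maximalRealSubfield L))
    (hq : ∀ X j h i v, Measurable (q X j h i v))
    (γ : ∀ X : skewMatrices ((IsCMField.complexConj L : L ≃ₐ[Fp L] L) : L →+* L) ((gramR L e dV hdV dW hdW).map (algebraMap (Fp L) L)),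
      ι X → HA L e dV hdV dW hdW → φ → HeightOneSpectrum (𝓞 ↥(maximalRealSubfield L)) → ℂ)
    (a : ∀ X : skewMatrices ((IsCMField.complexConj L : L ≃ₐ[Fp L] L) : L →+* L) ((gramR L e dV hdV dW hdW).map (algebraMap (Fp L) L)),
      ι X → HA L e dV hdV dW hdW → ∀ v : HeightOneSpectrum (𝓞 ↥(maximalRealSubfield L)), v.adicCompletion ↥(maximalRealSubfield L))
    (hclass' : ∀ X : skewMatrices ((IsCMField.complexConj L : L ≃ₐ[Fp L] L) : L →+* L) ((gramR L e dV hdV dW hdW).map (algebraMap (Fp L) L)),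
      (X : Matrix (Fin n) (Fin n) L) ≠ 0 → (X : Matrix (Fin n) (Fin n) L).det = 0 → ∀ (j : ι X) (h : HA L e dV hdV dW hdW), ∀ v ∈ Tf X j h,
      ¬ (hilbertSymbol (v.adicCompletion ↥(maximalRealSubfield L)) (algebraMap ↥(maximalRealSubfield L) _ (val X))
          (algebraMap ↥(maximalRealSubfield L) _ (cmQuadraticGenerator L : ↥(maximalRealSubfield L))) = -1 ↔ v ∈ S₁) →
      hilbertSymbol (v.adicCompletion ↥(maximalRealSubfield L)) (-(σc X v * (a X j h v)⁻¹))
        (algebraMap ↥(maximalRealSubfield L) (v.adicCompletion ↥(maximalRealSubfield L)) (cmQuadraticGenerator L : ↥(maximalRealSubfield L))) = -1)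
    -- the support letter and the cone word, DEAD-GUARDED
    (hZ : ∀ X : skewMatrices ((IsCMField.complexConj L : L ≃ₐ[Fp L] L) : L →+* L) ((gramR L e dV hdV dW hdW).map (algebraMap (Fp L) L)),
      (X : Matrix (Fin n) (Fin n) L) ≠ 0 → (X : Matrix (Fin n) (Fin n) L).det = 0 → ∀ (j : ι X) (h : HA L e dV hdV dW hdW), ∀ i ∈ I X j h, ∀ v ∈ Tf X j h,
      ¬ (hilbertSymbol (v.adicCompletion ↥(maximalRealSubfield L)) (algebraMap ↥(maximalRealSubfield L) _ (val X))
          (algebraMap ↥(maximalRealSubfield L) _ (cmQuadraticGenerator L : ↥(maximalRealSubfield L))) = -1 ↔ v ∈ S₁) →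
      ∀ᵐ z ∂(ρ X j h i v), q X j h i v z = 0 ∨
        hilbertSymbol (v.adicCompletion ↥(maximalRealSubfield L)) (-(q X j h i v z * (a X j h v)⁻¹))
          (algebraMap ↥(maximalRealSubfield L) (v.adicCompletion ↥(maximalRealSubfield L)) (cmQuadraticGenerator L : ↥(maximalRealSubfield L))) = 1)
    (N₂val : ∀ X : skewMatrices ((IsCMField.complexConj L : L ≃ₐ[Fp L] L) : L →+* L) ((gramR L e dV hdV dW hdW).map (algebraMap (Fp L) L)),
      ι X → HA L e dV hdV dW hdW → φ → ∀ v : HeightOneSpectrum (𝓞 ↥(maximalRealSubfield L)), v.adicCompletion ↥(maximalRealSubfield L) → ℂ)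
    (hVdef' : ∀ X : skewMatrices ((IsCMField.complexConj L : L ≃ₐ[Fp L] L) : L →+* L) ((gramR L e dV hdV dW hdW).map (algebraMap (Fp L) L)),
      (X : Matrix (Fin n) (Fin n) L) ≠ 0 → (X : Matrix (Fin n) (Fin n) L).det = 0 → ∀ (j : ι X) (h : HA L e dV hdV dW hdW), ∀ i ∈ I X j h, ∀ v ∈ Tf X j h, ∀ k : ℕ,
      V X j h i v k = ∫ x in primePowBall (v.adicCompletion (maximalRealSubfield L)) (-(k : ℤ)),
        conj ((((adeleAddCharAt (maximalRealSubfield L) v) (σc X v * x) : Circle) : ℂ)) * N₂val X j h i v x ∂(μ v))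
    (hcone : ∀ X : skewMatrices ((IsCMField.complexConj L : L ≃ₐ[Fp L] L) : L →+* L) ((gramR L e dV hdV dW hdW).map (algebraMap (Fp L) L)),
      (X : Matrix (Fin n) (Fin n) L) ≠ 0 → (X : Matrix (Fin n) (Fin n) L).det = 0 → ∀ (j : ι X) (h : HA L e dV hdV dW hdW), ∀ i ∈ I X j h, ∀ v ∈ Tf X j h,
      ¬ (hilbertSymbol (v.adicCompletion ↥(maximalRealSubfield L)) (algebraMap ↥(maximalRealSubfield L) _ (val X))
          (algebraMap ↥(maximalRealSubfield L) _ (cmQuadraticGenerator L : ↥(maximalRealSubfield L))) = -1 ↔ v ∈ S₁) →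
      ∀ x : v.adicCompletion ↥(maximalRealSubfield L),
      N₂val X j h i v x = γ X j h i v *
        ∫ z, (((adeleAddCharAt (maximalRealSubfield L) v) (x * q X j h i v z) : Circle) : ℂ) * G X j h i v z ∂(ρ X j h i v)) :
    ∀ X : skewMatrices ((IsCMField.complexConj L : L ≃ₐ[Fp L] L) : L →+* L) ((gramR L e dV hdV dW hdW).map (algebraMap (Fp L) L)),
      (X : Matrix (Fin n) (Fin n) L) ≠ 0 → (X : Matrix (Fin n) (Fin n) L).det = 0 → ∀ (j : ι X) (h : HA L e dV hdV dW hdW), ∀ i ∈ I X j h, ∀ v ∈ Tf X j h,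
      ¬ (hilbertSymbol (v.adicCompletion ↥(maximalRealSubfield L)) (algebraMap ↥(maximalRealSubfield L) _ (val X))
          (algebraMap ↥(maximalRealSubfield L) _ (cmQuadraticGenerator L : ↥(maximalRealSubfield L))) = -1 ↔ v ∈ S₁) →
      ∃ k₁ : ℕ, ∀ k, k₁ ≤ k → V X j h i v k = 0 := by
  intro X hX0 hdet j h i hi v hv hdead
  haveI : SFinite (ρ X j h i v) := hρ X j h i v
  obtain ⟨d, hd⟩ := (isContinuousNontrivial_adeleAddCharAt ↥(maximalRealSubfield L) v).exists_hasConductorExp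
  obtain ⟨k₁, hk₁⟩ := exists_forall_setIntegral_conj_addChar_mul_coneWord_eq_zero ↥(maximalRealSubfield L) v (μ v)
    (adeleAddCharAt ↥(maximalRealSubfield L) v) (isContinuousNontrivial_adeleAddCharAt ↥(maximalRealSubfield L) v).1 hd
    (ρ X j h i v) (hG X j h i v) (hq X j h i v) (γ X j h i v) (N₂val X j h i v) (fun x => hcone X hX0 hdet j h i hi v hv hdead x)
    (hσ X v) (hclass' X hX0 hdet j h v hv hdead) (hZ X hX0 hdet j h i hi v hv hdead)
  refine ⟨k₁, fun k hk => ?_⟩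
  rw [hVdef' X hX0 hdet j h i hi v hv k]
  exact hk₁ k hk

end BallRoadGuarded

end Summit.HodgeConjecture.HodgeConjecture.Cruxes.HLiu418.K2LiuLocalSWSeamOfRecordGuarded

end
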